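import Summits.NavierStokesRegularity.FluidComputer.PalasekTowerEpisodesPinned
import Literature.Analysis.FluidPDE.Vorticity

/-!
# The REGISTER of the E–C route (SPLIT v2): schedule rigidity, the core ledger, the registered margin,
# and the two items of record `EpisodeBaseR` / `EpisodeInductionR`

Cell `ns-blowup`, planner seat `ns-blowup-plan` (g16), RULINGS STATUS l.999 / l.1039 (REGISTER v2.1,
2026-08-25, file `plan/route-draft-v2.1/Register.lean` ca47ddc19161a832), landed by the typist
`ns-blowup-lean` (g2) verbatim up to bookkeeping lemmas (`CoreLedger.mono`, `Margins.register_mono`,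
rate arithmetic) and the `@[conjecture]` tags on the two items. LABEL: E–C typing (KERNEL vocabulary;
definitions + two NAMED open `Prop`s at registered parameters). WHAT THIS IS NOT: not Navier–Stokes
evidence — no instance is claimed anywhere.

## Why these pins (planner l.999, refuter K-PROBE l.911, referee l.916)

With `(datum, force)` fixed the finite-energy classical solution is unique (Tao 2013, Cor. 11.4 — the
route's hypothesis `hU`), so a `∀`-schedule induction step is consistent only if nothing the stage
`k+1` must meet is FREE schedule data beyond what the levels `≤ k` already fixed. `Schedule.Rigid`
removes the free futures found at the desk («tail re-timing», l.999 (K); the level-1 hole of the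
clock-equality draft, lean g2 l.1017 (4)) — REGISTER v2.1 (planner l.1021): WINDOW EQUALITY
`τ_{k+1} = τ_k + c₅ log N_{k+1} / A_k` (every readout time is level-0 data: nothing in the tail is
re-timable, at ANY level, with `c₃` and `T` left free — the clock inequality then forces `T = sup τ`),
the quiet constant `c₅ = 4 b β` (the loosest window), and the amplitude constants BY VALUE
(`c₁ = 1`, `c₂ = 5/3`: no constants ratchet; with `θ = 6/5` the separation pin reads
`2 Y_k ≤ Y_{k+1}`, which is `TowerRates.wide_sep`). The clock-equality draft (l.1001) is WITHDRAWN: it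
forces dormant waits `c₃/A_k ≫ c₅ log N_{k+2}/A_{k+1}` (ratio `≍ N_k^{β(b-1)}/log N_k → ∞`), so the
ceiling `c₂ Y_{k+1}` on `[0, τ_{k+2}]` would be breached by the next level deep in the tower. `CoreLedger` is hypothesis (H-core) of
`Literature.Barriers.NavierStokesRegularity.PalasekTowerKelvinCeiling` made explicit AT READOUT and
EXISTENTIAL in the loop (pre-labelled loops `S.loop` and scheduled circulations `S.Φ` are not read:
they are free schedule data, and an upper label-length pin together with a lower `Φ` pin would empty
every stage). [cite: Palasek2026ElementaryModel, §3–§4] [cite: Tao2011, Cor. 11.4]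
-/

noncomputable section

namespace Summit.NavierStokesRegularity.FluidComputer.PalasekTowerClayBridge

open Set MeasureTheory Filter Topology Function Real
open scoped ENNReal ContDiff NNReal
open Literature.Analysis.FluidPDE

/-- **Schedule rigidity** (planner register v2.1): WINDOW EQUALITY (the gap between consecutive
readouts is exactly the growth window of the next level, so all readout times are level-0 data), the
quiet constant is the loosest admissible one, and the amplitude constants are registered by value.
[cite: Palasek2026ElementaryModel, §3.3] -/
structure Schedule.Rigid {R : TowerRates} (S : Schedule R) : Prop where
  /-- window equality: `τ (k+1) = τ k + c₅ log N_{k+1} / A_k` — no dormant segment, no re-timing -/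
  window_eq : ∀ k, S.τ (k + 1) = S.τ k + S.c₅ * Real.log (R.N (k + 1)) / R.A k
  /-- the quiet constant is the loosest admissible one (`c₅_le` with equality) -/
  c₅_eq : S.c₅ = 4 * R.b * R.β
  /-- floor constant registered by value -/
  c₁_eq : S.c₁ = 1
  /-- ceiling constant registered by value (band `×5/3`; with `θ = 6/5`, `θ c₂ = 2 = 2 c₁`) -/
  c₂_eq : S.c₂ = 5 / 3

/-- **The core ledger at readout** ((H-core) of the Kelvin ceiling, existential form): at each readout
`τ j`, `j ≤ k`, some `C¹` closed loop of speed `≤ 8π / N_j` (hence length `≤ 8π / N_j`) inside a ball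
of radius `1 / N_j` centred in the tower's ball carries circulation `≥ c₁ N_j^{β-2}` — an intense
compact structure of amplitude `≍ A_j` at scale `1/N_j`, read through Stokes. [cite: Palasek2026ElementaryModel, §3.1] -/
def CoreLedger (R : TowerRates) (S : Schedule R) (k : ℕ)
    (u : ℝ → EuclideanSpace ℝ (Fin 3) → EuclideanSpace ℝ (Fin 3)) : Prop :=
  ∀ j, j ≤ k → ∃ (x : EuclideanSpace ℝ (Fin 3)) (γ : ℝ → EuclideanSpace ℝ (Fin 3)),
    ‖x‖ ≤ S.radius ∧ ContDiff ℝ 1 γ ∧ γ 0 = γ 1 ∧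
    (∀ s ∈ Icc (0 : ℝ) 1, γ s ∈ Metric.closedBall x (1 / R.N j)) ∧
    (∀ s ∈ Icc (0 : ℝ) 1, ‖deriv γ s‖ ≤ 8 * π / R.N j) ∧
    S.c₁ * R.N j ^ (R.β - 2) ≤ circulation (u (S.τ j)) γ

/-- **The registered margin** of the E–C route: schedule rigidity (a schedule-level conjunct, read at
every stage) and the core ledger at readout. The strain floor is added on top by
`Margins.withStrain` inside `EpisodeBasePinned` / `EpisodeInductionPinned`. [cite: Palasek2026ElementaryModel, §3–§4] -/
def Margins.register (R : TowerRates) : Margins R := fun S k u => S.Rigid ∧ CoreLedger R S k u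

/-- The core ledger is monotone in the level (it only accumulates readout clauses). [folklore] -/
theorem CoreLedger.mono {R : TowerRates} {S : Schedule R} {k k' : ℕ} (hk : k ≤ k')
    {u : ℝ → EuclideanSpace ℝ (Fin 3) → EuclideanSpace ℝ (Fin 3)} (h : CoreLedger R S k' u) :
    CoreLedger R S k u :=
  fun j hj => h j (hj.trans hk)

/-- A stage for the registered margin sits in a rigid schedule. [folklore] -/
theorem Margins.register_rigid {R : TowerRates} {S : Schedule R} {k : ℕ}
    {u : ℝ → EuclideanSpace ℝ (Fin 3) → EuclideanSpace ℝ (Fin 3)} (h : Margins.register R S k u) :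
    S.Rigid :=
  h.1

/-- … and carries the core ledger. [folklore] -/
theorem Margins.register_coreLedger {R : TowerRates} {S : Schedule R} {k : ℕ}
    {u : ℝ → EuclideanSpace ℝ (Fin 3) → EuclideanSpace ℝ (Fin 3)} (h : Margins.register R S k u) :
    CoreLedger R S k u :=
  h.2

/-- The registered margin is monotone in the level. [folklore] -/
theorem Margins.register_mono {R : TowerRates} {S : Schedule R} {k k' : ℕ} (hk : k ≤ k')
    {u : ℝ → EuclideanSpace ℝ (Fin 3) → EuclideanSpace ℝ (Fin 3)} (h : Margins.register R S k' u) :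
    Margins.register R S k u :=
  ⟨h.1, h.2.mono hk⟩

/-- Under rigidity the readout gaps are the growth windows, hence positive: the schedule's own
`τ_lt_succ` forces `0 < c₅ log N_{k+1} / A_k`. [folklore] -/
theorem Schedule.Rigid.window_pos {R : TowerRates} {S : Schedule R} (h : S.Rigid) (k : ℕ) :
    0 < S.c₅ * Real.log (R.N (k + 1)) / R.A k := by
  have h1 := h.window_eq k
  have h2 := S.τ_lt_succ k
  linarith

/-- **K1R of record** — one pinned, rigid, cored, strained episode at unit viscosity on the wide-base
rates, impulse dial `Λ = 8`, separation `θ = 6/5` (open; never asserted). [cite: Palasek2026ElementaryModel, §4] -/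
@[conjecture] def EpisodeBaseR : Prop :=
  EpisodeBasePinned 1 TowerRates.wide 8 (6 / 5) (Margins.register TowerRates.wide)

/-- **K2R of record** — heredity over the registered class at unit viscosity (open; the hard piece;
declared physics bet: AUTONOMOUS heredity — the admissible future force is a nuisance, never a
resource, planner l.1015). [cite: Palasek2026ElementaryModel, §4] -/
@[conjecture] def EpisodeInductionR : Prop :=
  EpisodeInductionPinned 1 TowerRates.wide 8 (6 / 5) (Margins.register TowerRates.wide)

/-- K1R ∧ K2R of record ⇒ the interface is inhabited at unit viscosity on the wide-base rates.
[cite: Palasek2026ElementaryModel, §4] -/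
theorem nonempty_realisation_of_episodesR (h₁ : EpisodeBaseR) (h₂ : EpisodeInductionR) :
    Nonempty (Realisation 1 TowerRates.wide) :=
  nonempty_realisation_of_episodesPinned h₁ h₂

/-- Sanity: the registered margin is tail-rigid — the quiet constant of a registered schedule is the
maximal one. [folklore] -/
theorem Margins.register_c₅ {R : TowerRates} {S : Schedule R} {k : ℕ}
    {u : ℝ → EuclideanSpace ℝ (Fin 3) → EuclideanSpace ℝ (Fin 3)} (h : Margins.register R S k u) :
    S.c₅ = 4 * R.b * R.β := h.1.c₅_eq

/-- Sanity («no re-timing», kernel form): under rigidity every readout time is determined by `τ 0`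
and the constants — `τ (k+1) = τ 0 + Σ_{j ≤ k} c₅ log N_{j+1} / A_j`. [folklore] -/
theorem Schedule.Rigid.τ_eq_sum {R : TowerRates} {S : Schedule R} (h : S.Rigid) (k : ℕ) :
    S.τ (k + 1) = S.τ 0 + ∑ j ∈ Finset.range (k + 1), S.c₅ * Real.log (R.N (j + 1)) / R.A j := by
  induction k with
  | zero => simp [h.window_eq 0]
  | succ n ih => rw [Finset.sum_range_succ, h.window_eq (n + 1), ih]; ring

/-- Sanity: two rigid schedules on the same rates with the same `τ 0` have the same readout times.
[folklore] -/
theorem Schedule.Rigid.τ_eq_of_τ_zero_eq {R : TowerRates} {S S' : Schedule R} (h : S.Rigid)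
    (h' : S'.Rigid) (h0 : S.τ 0 = S'.τ 0) : S.τ = S'.τ := by
  funext k
  cases k with
  | zero => exact h0
  | succ n =>
    rw [h.τ_eq_sum n, h'.τ_eq_sum n, h0, h.c₅_eq, h'.c₅_eq]

/-- Sanity: the registered separation pin `θ c₂ Y_k ≤ c₁ Y_{k+1}` at `θ = 6/5` is exactly
`2 Y_k ≤ Y_{k+1}` on a rigid schedule, i.e. `TowerRates.wide_sep` on the wide-base rates. [folklore] -/
theorem Schedule.Rigid.sep_wide {S : Schedule TowerRates.wide} (h : S.Rigid) (k : ℕ) :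
    (6 / 5 : ℝ) * (S.c₂ * TowerRates.wide.Y k) ≤ S.c₁ * TowerRates.wide.Y (k + 1) := by
  rw [h.c₁_eq, h.c₂_eq]
  have := TowerRates.wide_sep k
  linarith

end Summit.NavierStokesRegularity.FluidComputer.PalasekTowerClayBridge

end
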